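import Mathlib
import HarnessLib
import Summits.SmoothPoincare4.SmoothPoincare4.Theses.SmoothBijectionDefect
import Literature.Topology.FourManifolds.FiniteHomogeneity

/-!
# StrategyCensus — typed statements referred to by `STRATEGY-CENSUS.md` (crux `ShRigid`, stmt-SmoothPoincare4-13496)

Strategist seat `planner-cstrat-stmt-SmoothPoincare4-13496-s1-0`, 2026-08-17. Definitions only (every `def` is a
`Prop`); the two `theorem`s are sorry-free sanity facts. Nothing here is a route item or a stub.

* `NowhereDenseCoembeddable` — the strengthening S1 that FORGETS the bijection (census §Strengthen): false as soon as a
  fake Σ exists (3-skeleton of a triangulation), so it buys nothing.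
* `FiniteDefectThinning` — the strengthening S2 / by-dimension split D3 ("comparable ⇒ comparable with finite defect"):
  would close the crux via the finite rung, but is (α)-hard and implausible.
* `EngulfToOfFinite` — the finite rung of the engulf line's apex (census §Decomposition D3; PROVABLE NOW from
  `Literature.Topology.FourManifolds.Diffeomorph.exists_image_subset_of_finite`), typed for the lead.
* `engulfTo_iff_remark` — (documentation) the shape of the exactness claim E_T ⟺ T.
-/

set_option linter.dupNamespace false

noncomputable section

namespace Summit.SmoothPoincare4.SmoothPoincare4.Cruxes.ShRigid.Census

open scoped Manifold ContDiff Topology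
open Literature.Topology.FourManifolds
open Summit.SmoothPoincare4.SmoothPoincare4.Theses.SmoothBijectionDefect

/-- Local notation: the model space `ℝ⁴ = EuclideanSpace ℝ (Fin 4)`. -/
local notation "ℝ⁴" => EuclideanSpace ℝ (Fin 4)

/-- Local notation: the round 4-sphere. -/
local notation "𝕊⁴" => (Metric.sphere (0 : EuclideanSpace ℝ (Fin 5)) 1)

/-- **S1 (census §Strengthen) — the bijection-free strengthening.** "If a closed (hence compact) NOWHERE-DENSE `K ⊆ M` has complement
smoothly embeddable in `S⁴`, then `K` is engulfed by a chart domain." FALSE as typed (paper proof; `M = ℂP²`, `K` = the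
3-skeleton of a smooth triangulation: complement = disjoint open 4-simplices embeds in `S⁴`; `K` engulfed by a chart `U`
⇒ `M ∖ U` lies in one simplex ⇒ `M = B⁴ ∪ W`, `W ⊂ ℝ⁴`, `∂W = S³` ⇒ `H₂ M = 0`, absurd), and on homotopy 4-spheres the
same `K` makes it EQUIVALENT to (A) "every Σ is a unit" — it forgets exactly the datum (the embedding of `M ∖ K`
extends to a continuous BIJECTION `M → S⁴` across `K`, i.e. comparability) that separates ShRigid from (A).
[conjecture: strategist planner-cstrat-stmt-SmoothPoincare4-13496-s1-0 — recorded as a REFUTED-IN-PRINCIPLE strengthening, not proposed] -/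
def NowhereDenseCoembeddable : Prop :=
  ∀ (M : Type) [TopologicalSpace M] [T2Space M] [SecondCountableTopology M]
    [ChartedSpace ℝ⁴ M] [IsManifold (𝓡 4) ∞ M] [CompactSpace M] [ConnectedSpace M]
    (K : Set M) (hK : IsClosed K), interior K = ∅ →
      (∃ e : (⟨Kᶜ, hK.isOpen_compl⟩ : TopologicalSpace.Opens M) → 𝕊⁴,
          Manifold.IsSmoothEmbedding (𝓡 4) (𝓡 4) ∞ e) →
      ∃ φ : ℝ⁴ → M, ContMDiff (𝓡 4) (𝓡 4) ∞ φ ∧ Function.Injective φ ∧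
        IsLocalDiffeomorph (𝓡 4) (𝓡 4) ∞ φ ∧ K ⊆ Set.range φ

/-- **S2 / D3 (census §Strengthen, §Decomposition) — finite-defect thinning.** "A homotopy 4-sphere that maps smoothly and
bijectively onto `S⁴` does so with FINITE defect." Together with the finite rung `EngulfToOfFinite` and the engulf line's
plumbing this would close the `Σ → S⁴` half of the crux; but producing a comparison map with small defect is an
(α)-type CONSTRUCTION (sibling crux ThinDefect) and for a fake non-unit Σ it is false (finite defect ⇒ unit), so as a
lemma it is exactly as strong as the half-crux it would serve — no leverage.
[conjecture: strategist planner-cstrat-stmt-SmoothPoincare4-13496-s1-0 — implausible strengthening, recorded not proposed] -/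
def FiniteDefectThinning : Prop :=
  ∀ S : HomotopySphere 4,
    (∃ g : S.carrier → 𝕊⁴, ContMDiff (𝓡 4) (𝓡 4) ∞ g ∧ Function.Bijective g) →
      ∃ g : S.carrier → 𝕊⁴, ContMDiff (𝓡 4) (𝓡 4) ∞ g ∧ Function.Bijective g ∧
        {y | ¬ IsLocalDiffeomorphAt (𝓡 4) (𝓡 4) ∞ g y}.Finite

/-- **D3 finite rung (census §Decomposition) — PROVABLE NOW.** On a closed CONNECTED smooth 4-manifold every finite set is
engulfed by a chart domain: move it into the source of a full-target chart by
`Literature.Topology.FourManifolds.Diffeomorph.exists_image_subset_of_finite` and pull the chart back. This is the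
`K finite` case of the engulf line's apex stubs (for `g` with finite defect, resp. `f` with finite defect image), i.e.
the route's calibrated one-point rung `UnitOfOnePointDefect` for ANY finite defect, with no flatness analysis.
[folklore] -/
def EngulfToOfFinite : Prop :=
  ∀ (M : Type) [TopologicalSpace M] [T2Space M] [SecondCountableTopology M]
    [ChartedSpace ℝ⁴ M] [IsManifold (𝓡 4) ∞ M] [CompactSpace M] [ConnectedSpace M]
    (K : Set M), K.Finite →
      ∃ φ : ℝ⁴ → M, ContMDiff (𝓡 4) (𝓡 4) ∞ φ ∧ Function.Injective φ ∧
        IsLocalDiffeomorph (𝓡 4) (𝓡 4) ∞ φ ∧ K ⊆ Set.range φ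

/-- Sanity: `FiniteDefectThinning` is at least as strong as what it would be used for — it hands the engulf line a
finite defect, which `EngulfToOfFinite` engulfs (pure logic over the two defs; the connectedness of a homotopy sphere is
supplied as a hypothesis to keep this file import-light). [folklore] -/
theorem engulf_of_thinning_of_finiteRung (hT : FiniteDefectThinning) (hF : EngulfToOfFinite)
    (S : HomotopySphere 4) [ConnectedSpace S.carrier]
    (hS : ∃ g : S.carrier → 𝕊⁴, ContMDiff (𝓡 4) (𝓡 4) ∞ g ∧ Function.Bijective g) :
    ∃ (g : S.carrier → 𝕊⁴) (φ : ℝ⁴ → S.carrier), ContMDiff (𝓡 4) (𝓡 4) ∞ g ∧ Function.Bijective g ∧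
      ContMDiff (𝓡 4) (𝓡 4) ∞ φ ∧ Function.Injective φ ∧ IsLocalDiffeomorph (𝓡 4) (𝓡 4) ∞ φ ∧
      ∀ y, ¬ IsLocalDiffeomorphAt (𝓡 4) (𝓡 4) ∞ g y → y ∈ Set.range φ := by
  obtain ⟨g, hg, hbij, hfin⟩ := hT S hS
  obtain ⟨φ, hφ, hinj, hloc, hK⟩ := hF S.carrier _ hfin
  exact ⟨g, φ, hg, hbij, hφ, hinj, hloc, fun y hy => hK hy⟩

end Summit.SmoothPoincare4.SmoothPoincare4.Cruxes.ShRigid.Census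

end
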